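/-
Copyright: the b2b-balaban T⁴-continuum CRUX team, row NE7b OWNER lineage `t4-ne7b-p1` (gen 145). Project licence.
-/
import Summits.QuantumFields.BalabanUV.T4Continuum.Spine.NE7b.SupKernelClassFifthOrderEntry
import Summits.QuantumFields.BalabanUV.T4Continuum.Spine.NE7b.SupFifthKernelEntryLetterSlotFour
import Summits.QuantumFields.BalabanUV.T4Continuum.Spine.NE7b.SupFifthKernelEntryLetterSlotFive
import Summits.QuantumFields.BalabanUV.T4Continuum.Spine.NE7b.SupKernelSchurQuintilinear

/-!
# THE OPERATOR LETTER OF THE FIFTH DERIVATIVE, GENERAL `Γ = AAᵀ` (the `C⁵` repackaging's last letter; (534) one order up; SCOPING-d16 §B (C)).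
# (639)∕(641): the output's order-5 object is the `5`-linear map `P(ψ)` (composed form, the Fréchet derivative of (533)'s `Q`), with the
# entry majorant `|P(ψ)[e_x][e_y][e_z,e_t,e_s]| ≤ K5⁺(x; y,z,t,s)` ((641) `output_fifth_entry_format`, (610)'s 52-term majorant); (629)∕(634):
# the slot letters of `K5⁺` with the display index `t`, resp. `s`, fixed — `k5s3⁺`, `k5s4⁺` (twelve summands each, explicit in the input's
# letters); (536): Schur at order 5 (`‖P‖ ≤ √(L₄L₅)` from the slot-4 and slot-5 letters of the entries).  Here, THE END:
#   `‖P(ψ)‖ ≤ √(k5s3⁺ · k5s4⁺)`, uniformly in the background `ψ` and the volume,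
# the OPERATOR clause `hU₅b : ‖U₅ φ‖ ≤ κ₅` of the next step's input with `U₅ := P`, `κ₅⁺ := √(k5s3⁺·k5s4⁺)` (row NE7b, node U5c; (641), (629),
# (634), (536) BY NAME; [folklore]).  Any two distinct display slots would do; `t, s` are chosen because their letters are the shortest (as
# (530)∕(534) chose slots 3, 4 at order four).  The re-ordering `Σ_xΣ_yΣ_zΣ_s ↝ Σ_yΣ_zΣ_sΣ_x` between (536)'s slot sums and the slot files'
# convention (row index innermost) is §1's one abstract lemma.

Cell `pub-balaban`, sub-cell `t4`, spine estimate NE7b (`T4WeightBudget.RelWeightBound`; the cell's OWN estimate — NOT PRINTED in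
[Bałaban 1983–89], NOT PROVED).  Crux-route work under `Spine/NE7b/` by the row OWNER (`t4-ne7b-p1` gen 145, file (643)) under FREEZE
(0)'s crux-prover clause; NOTHING of Bałaban's is named as a Lean object, valued or asserted; no `T4Continuum/Support` leaf typed; no
`def`, no notation (`P(ψ)` and both letters WRITTEN OUT); zero `sorry`.  Imports (BY NAME): the OWNER's (641) `…SupKernelClassFifthOrderEntry`,
(629) `…SupFifthKernelEntryLetterSlotFour`, (634) `…SupFifthKernelEntryLetterSlotFive`, (536) `…SupKernelSchurQuintilinear`.

WHAT IS PROVED ([folklore]): §1 `sum4_first_to_last_le` (abstract re-ordering); §2 THE END **`fifth_order_operator_letter`**; §3 toy.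

HONEST (what this is NOT).  Bookkeeping BY NAME; the letter `√(k5s3⁺·k5s4⁺)` GROWS per step before rescaling (the FLOW is NOT claimed);
the CONTINUITY of `P` in `ψ` (the input's `hU₅c`) is NOT here; `D`, its letters, the weights, the site∕support letters and the constants
`C3k, C3h, C4, C5` (with their defining lower bounds and `0 ≤ C4, 0 ≤ C5`) are hypotheses; ORDER SIX NOT typed; scalar skeleton ((A3),
NC-NE7b-α UNRULED); nothing of Bałaban's asserted.  BY-NAME EFFECT ON THE WALL: NONE.  NE7b NOT PRINTED ∕ NOT PROVED; spine PROVED 0∕9;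
rung (B)+1 — the programme's measures remain FINITE-torus statements; NOT the mass gap, NOT Clay.  HONEST DEPENDENCY: continuum YM on
T⁴ ⇐ BetaPertH ∧ nine spine estimates (0∕9 proved); BetaPertH ⇐ (D1) ∧ (D4) ∧ CAP+tail; G-an2-4 gates asym, D1 and NE2∕3∕4.
-/

set_option autoImplicit false
set_option maxSynthPendingDepth 4

noncomputable section

namespace Summit.QuantumFields.BalabanUV.T4Continuum.NE7b.SupFifthOrderOperatorLetter

open MeasureTheory ProbabilityTheory Finset Real Matrix
open scoped BigOperators Matrix Topology
open SupKernelClassFifthOrderEntry (output_fifth_entry_format)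
open SupFifthKernelEntryLetterSlotFour (entry_majorant5_slot_t)
open SupFifthKernelEntryLetterSlotFive (entry_majorant5_slot_s)
open SupKernelSchurQuintilinear (opNorm_le_of_slot_letters_five)

/-! ## §1. The re-ordering between (536)'s slot sums and the slot files' convention -/

section Reorder

variable {ι : Type} [Fintype ι]

/-- **First index to last**: an entrywise majorant summed with the first index innermost bounds the sum with the first index outermost.
[folklore] -/
theorem sum4_first_to_last_le {g M : ι → ι → ι → ι → ℝ} {L : ℝ} (hle : ∀ a b c d, g a b c d ≤ M a b c d)
    (hM : ∑ b, ∑ c, ∑ d, ∑ a, M a b c d ≤ L) : ∑ a, ∑ b, ∑ c, ∑ d, g a b c d ≤ L :=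
  calc ∑ a, ∑ b, ∑ c, ∑ d, g a b c d ≤ ∑ a, ∑ b, ∑ c, ∑ d, M a b c d :=
        Finset.sum_le_sum fun a _ => Finset.sum_le_sum fun b _ => Finset.sum_le_sum fun c _ => Finset.sum_le_sum fun d _ => hle a b c d
    _ = ∑ b, ∑ a, ∑ c, ∑ d, M a b c d := Finset.sum_comm
    _ = ∑ b, ∑ c, ∑ a, ∑ d, M a b c d := Finset.sum_congr rfl fun _ _ => Finset.sum_comm
    _ = ∑ b, ∑ c, ∑ d, ∑ a, M a b c d := Finset.sum_congr rfl fun _ _ => Finset.sum_congr rfl fun _ _ => Finset.sum_comm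
    _ ≤ L := hM

end Reorder

/-! ## §2. THE END: the operator letter of `P(ψ)` -/

section TheEnd

variable {ι κ : Type} [Fintype ι] [DecidableEq ι] [Fintype κ] [DecidableEq κ] {U : EuclideanSpace ℝ ι → ℝ} {U' : EuclideanSpace ℝ ι →
        EuclideanSpace ℝ ι →L[ℝ] ℝ}
  {U'' : EuclideanSpace ℝ ι → EuclideanSpace ℝ ι →L[ℝ] EuclideanSpace ℝ ι →L[ℝ] ℝ}
  {U₃ : EuclideanSpace ℝ ι → EuclideanSpace ℝ ι →L[ℝ] EuclideanSpace ℝ ι →L[ℝ] EuclideanSpace ℝ ι →L[ℝ] ℝ}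
  {U₄ : EuclideanSpace ℝ ι → EuclideanSpace ℝ ι →L[ℝ] EuclideanSpace ℝ ι →L[ℝ] EuclideanSpace ℝ ι →L[ℝ] EuclideanSpace ℝ ι →L[ℝ] ℝ}
  {U₅ : EuclideanSpace ℝ ι →
    EuclideanSpace ℝ ι →L[ℝ] EuclideanSpace ℝ ι →L[ℝ] EuclideanSpace ℝ ι →L[ℝ] EuclideanSpace ℝ ι →L[ℝ] EuclideanSpace ℝ ι →L[ℝ] ℝ}
  {Hk : ι → ι → ℝ} {K3 : ι → ι → ι → ℝ} {K4 : ι → ι → ι → ι → ℝ} {K5 : ι → ι → ι → ι → ι → ℝ} {A : Matrix ι κ ℝ} {D : κ → κ → ℝ}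
  {γop κ₀ κ₁ κ₂ κ₃ κ₄ κ₅ κ₅r a τ δ θp lam lamA αr αc hr hc k3r k3c k3m k4r k4c k4s2 k4s3 k5r k5c k5s3 k5s4 γ dr dc dθ dθ' αθ βθ S S' S₁ n₃ : ℝ} {θ
        : κ → κ → ℝ}
  {σ : ι → κ → ℝ} {ρ r : ι → ι → ℝ} {C3k C3h C4 C5 : ℝ} {n : ℕ}

set_option synthInstance.maxHeartbeats 200000 in
set_option maxHeartbeats 6000000 in
set_option maxRecDepth 4096 in
/-- **THE END — THE OPERATOR LETTER OF THE FIFTH DERIVATIVE, GENERAL `Γ = AAᵀ`**: `‖P(ψ)‖ ≤ √(k5s3⁺·k5s4⁺)` with the two slot letters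
written out in the input's letters, uniformly in the background and the volume — (641) entrywise, (629)∕(634) summed, (536) Schur. [folklore] -/
theorem fifth_order_operator_letter [Nonempty κ]
(hΓop : (γop • (1 : Matrix ι ι ℝ) - A * Aᵀ).PosSemidef) (Y : Finset ι) (hUd : ∀ φ : EuclideanSpace ℝ ι, HasFDerivAt U (U' φ) φ) (hU'd : ∀ φ :
    EuclideanSpace ℝ ι, HasFDerivAt U' (U'' φ) φ) (hU''d : ∀ φ : EuclideanSpace ℝ ι, HasFDerivAt U'' (U₃ φ) φ) (hU₃d : ∀ φ : EuclideanSpace ℝ ι,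
    HasFDerivAt U₃ (U₄ φ) φ) (hU₄d : ∀ φ : EuclideanSpace ℝ ι, HasFDerivAt U₄ (U₅ φ) φ) (hU₅c : Continuous U₅) (hκ₀ : 0 ≤ κ₀) (hκ₁ : 0 ≤ κ₁) (ha : 0
    ≤ a) (hτ : 0 < τ) (hδ : 0 < δ) (hθ0 : 0 < θp) (hθ1 : θp < 1) (hκθ : (2 * κ₀ * (1 + τ) + 4 * δ) * γop ≤ θp) (hκθw : 2 * κ₀ * (1 + τ) * γop + 4 *
    δ ≤ θp) (hstab : ∀ φ : EuclideanSpace ℝ ι, -(κ₀ * ∑ x ∈ Y, φ x ^ 2) ≤ U φ) (hU'b : ∀ φ : EuclideanSpace ℝ ι, ‖U' φ‖ ≤ κ₁ * (a + ∑ x ∈ Y, φ x ^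
    2)) (hU''b : ∀ φ : EuclideanSpace ℝ ι, ‖U'' φ‖ ≤ κ₂) (hU₃b : ∀ φ : EuclideanSpace ℝ ι, ‖U₃ φ‖ ≤ κ₃) (hU₄b : ∀ φ : EuclideanSpace ℝ ι, ‖U₄ φ‖ ≤
    κ₄) (hU₅b : ∀ φ : EuclideanSpace ℝ ι, ‖U₅ φ‖ ≤ κ₅) (hlam : 0 ≤ lam) (hUsec : ∀ s : ℝ, 0 ≤ s → s ≤ 1 → ∀ a b : EuclideanSpace ℝ ι, U ((1 - s) • a
    + s • b) - lam / 2 * (s * (1 - s)) * ∑ i, (a i - b i) ^ 2 ≤ (1 - s) * U a + s * U b) (hρg : lam * γop < 1) (hHk : ∀ (φ : EuclideanSpace ℝ ι) (x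
    z : ι), |U'' φ (EuclideanSpace.single z (1 : ℝ)) (EuclideanSpace.single x (1 : ℝ))| ≤ Hk x z) (hHk0 : ∀ v u, 0 ≤ Hk v u) (hK3 : ∀ (φ :
    EuclideanSpace ℝ ι) (u x y : ι), |U₃ φ (EuclideanSpace.single u (1 : ℝ)) (EuclideanSpace.single x (1 : ℝ)) (EuclideanSpace.single y (1 : ℝ))| ≤
    K3 x y u) (hK30 : ∀ x y u, 0 ≤ K3 x y u) (hK4 : ∀ (φ : EuclideanSpace ℝ ι) (u x y z : ι), |U₄ φ (EuclideanSpace.single u (1 : ℝ))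
    (EuclideanSpace.single x (1 : ℝ)) (EuclideanSpace.single y (1 : ℝ)) (EuclideanSpace.single z (1 : ℝ))| ≤ K4 x y z u) (hK40 : ∀ x y z u, 0 ≤ K4 x
    y z u) (hK5 : ∀ (φ : EuclideanSpace ℝ ι) (u x y z t : ι), |U₅ φ (EuclideanSpace.single u (1 : ℝ)) (EuclideanSpace.single x (1 : ℝ))
    (EuclideanSpace.single y (1 : ℝ)) (EuclideanSpace.single z (1 : ℝ)) (EuclideanSpace.single t (1 : ℝ))| ≤ K5 x y z t u) (hhr : ∀ v, ∑ u, Hk v u ≤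
    hr) (ψ : EuclideanSpace ℝ ι) (hαr : ∀ u, ∑ w, |A u w| ≤ αr) (hαc : ∀ w, ∑ u, |A u w| ≤ αc) (hlamA : ∀ x : κ, ∑ u, ∑ v, |A u x| * |A v x| * Hk v
    u ≤ lamA) (hlamA1 : lamA < 1) (hγ : αc * hr * αr / (1 - lamA) ≤ γ) (hγ1 : γ < 1) (hD : ∀ x y, 0 ≤ D x y) (hDC : ∀ x y, (if x = y then (1 : ℝ)
    else 0) + ∑ z, D x z * ((if y = z then 0 else ∑ u, ∑ v, |A u y| * |A v z| * Hk v u) / (1 - lamA)) ≤ D x y) (hθnn : ∀ z w, 0 ≤ θ z w) (hDθr : ∀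
    z, ∑ w, D z w * θ z w ≤ dθ) (hdθ : 0 ≤ dθ) (hDθc : ∀ w, ∑ z, D z w * θ z w ≤ dθ') (hdθ' : 0 ≤ dθ') (hσ0 : ∀ x w, 0 ≤ σ x w) (hσθ : ∀ x z w, σ x
    w ≤ σ x z * θ z w) (hρ1 : ∀ x y, 1 ≤ ρ x y) (hρsymm : ∀ x y, ρ x y = ρ y x) (hρmul : ∀ x y z, ρ x z ≤ ρ x y * ρ y z) (hρσ : ∀ x y w, ρ x y ^ 8 ≤
    σ x w * σ y w) (hr1 : ∀ x y, 1 ≤ r x y) (hrσ : ∀ x y w, r x y ^ 24 ≤ σ x w * σ y w) (haσ : ∀ v : ι, ∑ w, (∑ u, |A u w| * Hk v u) * σ v w ≤ αθ)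
    (hβ : 0 ≤ βθ) (haσ' : ∀ (v : ι) (w : κ), (∑ u, |A u w| * Hk v u) * σ v w ≤ βθ) (hgσ : ∀ p q : ι, ∑ w, (∑ u, |A u w| * K3 p q u) * σ p w ≤ αθ)
    (hgσ' : ∀ (p q : ι) (w : κ), (∑ u, |A u w| * K3 p q u) * σ p w ≤ βθ) (hkσ : ∀ p q o : ι, ∑ w, (∑ u, |A u w| * K4 p q o u) * σ p w ≤ αθ) (hkσ' :
    ∀ (p q o : ι) (w : κ), (∑ u, |A u w| * K4 p q o u) * σ p w ≤ βθ) (hC3k : 4 * Real.sqrt ((5 * ((κ₂ ^ 4 + κ₄ ^ 4) * γop ^ 2) / (1 - lam * γop) ^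
    2) * (αθ * dθ * (βθ * dθ') / (1 - lamA))) ≤ C3k) (hC3h : 4 * Real.sqrt ((5 * ((κ₂ ^ 4 + κ₃ ^ 4) * γop ^ 2) / (1 - lam * γop) ^ 2) * (αθ * dθ *
    (βθ * dθ') / (1 - lamA))) ≤ C3h) (hC4 : (4 * (αθ * dθ * (βθ * dθ') / (1 - lamA)) + 3 * (αθ * dθ * (βθ * dθ') / (1 - lamA)) ^ 2 + 4 * (5 * ((κ₂ ^
    4 + κ₃ ^ 4) * γop ^ 2) / (1 - lam * γop) ^ 2) + 4 * (50 * ((κ₂ ^ 6 + κ₃ ^ 6) * γop ^ 3) / (1 - lam * γop) ^ 3) + 2 * (((5 * ((κ₂ ^ 4 + κ₃ ^ 4) *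
    γop ^ 2) / (1 - lam * γop) ^ 2) + 1) / 2) * ((((5 * ((κ₂ ^ 4 + κ₃ ^ 4) * γop ^ 2) / (1 - lam * γop) ^ 2) + 1) / 2) + (5 * ((κ₂ ^ 4 + κ₃ ^ 4) *
    γop ^ 2) / (1 - lam * γop) ^ 2))) ≤ C4) (hC5 : ((4 * (αθ * dθ * (βθ * dθ') / (1 - lamA)) + 5 * (50 * (κ₂ ^ 6 * γop ^ 3) / (1 - lam * γop) ^ 3) +
    (((5 * (κ₂ ^ 4 * γop ^ 2) / (1 - lam * γop) ^ 2) + 1) / 2) * (5 * (κ₂ ^ 4 * γop ^ 2) / (1 - lam * γop) ^ 2) + 2 * (αθ * dθ * (βθ * dθ') / (1 -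
    lamA)) * ((((5 * (κ₂ ^ 4 * γop ^ 2) / (1 - lam * γop) ^ 2) + 1) / 2) + (5 * (κ₂ ^ 4 * γop ^ 2) / (1 - lam * γop) ^ 2)) + 24 * (((5 * (κ₂ ^ 4 *
    γop ^ 2) / (1 - lam * γop) ^ 2) + 1) / 2) * Real.sqrt ((αθ * dθ * (βθ * dθ') / (1 - lamA)) * (5 * (κ₂ ^ 4 * γop ^ 2) / (1 - lam * γop) ^ 2))) +
    (6 * (αθ * dθ * (βθ * dθ') / (1 - lamA)) + 5 * (50 * (κ₂ ^ 6 * γop ^ 3) / (1 - lam * γop) ^ 3) + ((((5 * (κ₂ ^ 4 * γop ^ 2) / (1 - lam * γop) ^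
    2) + 1) / 2) + (5 * (κ₂ ^ 4 * γop ^ 2) / (1 - lam * γop) ^ 2)) ^ 2 / 2 + 3 * (((5 * (κ₂ ^ 4 * γop ^ 2) / (1 - lam * γop) ^ 2) + 1) / 2) * (5 *
    (κ₂ ^ 4 * γop ^ 2) / (1 - lam * γop) ^ 2) + 3 * (αθ * dθ * (βθ * dθ') / (1 - lamA)) * ((((5 * (κ₂ ^ 4 * γop ^ 2) / (1 - lam * γop) ^ 2) + 1) /
    2) + (5 * (κ₂ ^ 4 * γop ^ 2) / (1 - lam * γop) ^ 2)) + 12 * (((5 * (κ₂ ^ 4 * γop ^ 2) / (1 - lam * γop) ^ 2) + 1) / 2) * Real.sqrt ((αθ * dθ *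
    (βθ * dθ') / (1 - lamA)) * (5 * (κ₂ ^ 4 * γop ^ 2) / (1 - lam * γop) ^ 2)))) ≤ C5)
    (hK50 : ∀ x y z t u, 0 ≤ K5 x y z t u) (hhc : ∀ u, ∑ v,
    Hk v u ≤ hc) (hk3r : ∀ x, ∑ y, ∑ u, K3 x y u ≤ k3r) (hk3m : ∀ y, ∑ x, ∑ u, K3 x y u ≤ k3m) (hk3c : ∀ u, ∑ y, ∑ z, K3 y z u ≤ k3c) (hk4s2 : ∀ y,
    ∑ x, ∑ t, ∑ u, K4 x y t u ≤ k4s2) (hk4s3 : ∀ z, ∑ x, ∑ y, ∑ u, K4 x y z u ≤ k4s3) (hk4c : ∀ u, ∑ y, ∑ z, ∑ t, K4 y z t u ≤ k4c) (hk5s3 : ∀ z, ∑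
    x, ∑ y, ∑ t, ∑ u, K5 x y z t u ≤ k5s3) (hk5s4 : ∀ t, ∑ x, ∑ y, ∑ z, ∑ u, K5 x y z t u ≤ k5s4) (hk5c : ∀ u, ∑ y, ∑ z, ∑ t, ∑ s, K5 y z t s u ≤
    k5c) (hDr : ∀ z, ∑ w, D z w ≤ dr) (hDc : ∀ w, ∑ z, D z w ≤ dc) (hS : ∀ u, ∑ v, 1 / ρ u v ≤ S) (hrs : ∀ u v, r u v = r v u) (hSr : ∀ u, ∑ v, (r u
    v ^ 2)⁻¹ ≤ S') (hSc : ∀ v, ∑ u, (r u v ^ 2)⁻¹ ≤ S') (hS1 : ∀ u, ∑ v, (r u v)⁻¹ ≤ S₁) (hn : ∀ y : ι, (Finset.univ.filter (fun z => Hk z y ≠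
    0)).card ≤ n) (hn' : ∀ z : ι, (Finset.univ.filter (fun y => Hk z y ≠ 0)).card ≤ n) (hn3 : ∀ y : ι, ∑ z, ((Finset.univ.filter (fun t => K3 z t y
    ≠ 0)).card : ℝ) ≤ n₃) (hn3f : ∀ a : ι, ∑ b, ((Finset.univ.filter (fun c => K3 a b c ≠ 0)).card : ℝ) ≤ n₃) (hn3m : ∀ b : ι, ∑ a,
    ((Finset.univ.filter (fun c => K3 a b c ≠ 0)).card : ℝ) ≤ n₃) (hC40 : 0 ≤ C4) (hC50 : 0 ≤ C5) :
    ‖∑ x', ∑ y', ∑ z', ((ContinuousLinearMap.smulRightL ℝ (EuclideanSpace ℝ ι) (EuclideanSpace ℝ ι →L[ℝ] EuclideanSpace ℝ ι →L[ℝ] EuclideanSpace ℝ ι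
        →L[ℝ] ℝ)).flip ((EuclideanSpace.proj x' : EuclideanSpace ℝ ι →L[ℝ] ℝ).smulRight ((EuclideanSpace.proj y' : EuclideanSpace ℝ ι →L[ℝ]
        ℝ).smulRight (EuclideanSpace.proj z' : EuclideanSpace ℝ ι →L[ℝ] ℝ)))).comp (∑ n : ι, (fderiv ℝ (fun ψ'' : EuclideanSpace ℝ ι => (fderiv ℝ
        (fun ψ' : EuclideanSpace ℝ ι => ((∫ ω : EuclideanSpace ℝ ι, exp (-U (ω + ψ')) ∂(multivariateGaussian 0 (A * Aᵀ))))⁻¹ * (∫ ω : EuclideanSpace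
        ℝ ι, exp (-U (ω + ψ')) * (U₃ (ω + ψ') (EuclideanSpace.single x' (1 : ℝ)) (EuclideanSpace.single y' (1 : ℝ)) (EuclideanSpace.single z' (1 :
        ℝ)) - U' (ω + ψ') (EuclideanSpace.single y' (1 : ℝ)) * U'' (ω + ψ') (EuclideanSpace.single x' (1 : ℝ)) (EuclideanSpace.single z' (1 : ℝ)) -
        U'' (ω + ψ') (EuclideanSpace.single x' (1 : ℝ)) (EuclideanSpace.single y' (1 : ℝ)) * U' (ω + ψ') (EuclideanSpace.single z' (1 : ℝ)) - U' (ω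
        + ψ') (EuclideanSpace.single x' (1 : ℝ)) * U'' (ω + ψ') (EuclideanSpace.single y' (1 : ℝ)) (EuclideanSpace.single z' (1 : ℝ)) + U' (ω + ψ')
        (EuclideanSpace.single x' (1 : ℝ)) * U' (ω + ψ') (EuclideanSpace.single y' (1 : ℝ)) * U' (ω + ψ') (EuclideanSpace.single z' (1 : ℝ)))
        ∂(multivariateGaussian 0 (A * Aᵀ))) + ((∫ ω : EuclideanSpace ℝ ι, exp (-U (ω + ψ')) ∂(multivariateGaussian 0 (A * Aᵀ))) ^ 2)⁻¹ * (∫ ω :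
        EuclideanSpace ℝ ι, exp (-U (ω + ψ')) * U' (ω + ψ') (EuclideanSpace.single x' (1 : ℝ)) ∂(multivariateGaussian 0 (A * Aᵀ))) * (∫ ω :
        EuclideanSpace ℝ ι, exp (-U (ω + ψ')) * (U'' (ω + ψ') (EuclideanSpace.single y' (1 : ℝ)) (EuclideanSpace.single z' (1 : ℝ)) - U' (ω + ψ')
        (EuclideanSpace.single y' (1 : ℝ)) * U' (ω + ψ') (EuclideanSpace.single z' (1 : ℝ))) ∂(multivariateGaussian 0 (A * Aᵀ))) + ((∫ ω :
        EuclideanSpace ℝ ι, exp (-U (ω + ψ')) ∂(multivariateGaussian 0 (A * Aᵀ))) ^ 2)⁻¹ * (∫ ω : EuclideanSpace ℝ ι, exp (-U (ω + ψ')) * U' (ω +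
        ψ') (EuclideanSpace.single y' (1 : ℝ)) ∂(multivariateGaussian 0 (A * Aᵀ))) * (∫ ω : EuclideanSpace ℝ ι, exp (-U (ω + ψ')) * (U'' (ω + ψ')
        (EuclideanSpace.single x' (1 : ℝ)) (EuclideanSpace.single z' (1 : ℝ)) - U' (ω + ψ') (EuclideanSpace.single x' (1 : ℝ)) * U' (ω + ψ')
        (EuclideanSpace.single z' (1 : ℝ))) ∂(multivariateGaussian 0 (A * Aᵀ))) + (((∫ ω : EuclideanSpace ℝ ι, exp (-U (ω + ψ'))
        ∂(multivariateGaussian 0 (A * Aᵀ))) ^ 2)⁻¹ * (∫ ω : EuclideanSpace ℝ ι, exp (-U (ω + ψ')) * (U'' (ω + ψ') (EuclideanSpace.single x' (1 : ℝ))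
        (EuclideanSpace.single y' (1 : ℝ)) - U' (ω + ψ') (EuclideanSpace.single x' (1 : ℝ)) * U' (ω + ψ') (EuclideanSpace.single y' (1 : ℝ)))
        ∂(multivariateGaussian 0 (A * Aᵀ))) + -2 / (∫ ω : EuclideanSpace ℝ ι, exp (-U (ω + ψ')) ∂(multivariateGaussian 0 (A * Aᵀ))) ^ 3 * -(∫ ω :
        EuclideanSpace ℝ ι, exp (-U (ω + ψ')) * U' (ω + ψ') (EuclideanSpace.single x' (1 : ℝ)) ∂(multivariateGaussian 0 (A * Aᵀ))) * (∫ ω :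
        EuclideanSpace ℝ ι, exp (-U (ω + ψ')) * U' (ω + ψ') (EuclideanSpace.single y' (1 : ℝ)) ∂(multivariateGaussian 0 (A * Aᵀ)))) * (∫ ω :
        EuclideanSpace ℝ ι, exp (-U (ω + ψ')) * U' (ω + ψ') (EuclideanSpace.single z' (1 : ℝ)) ∂(multivariateGaussian 0 (A * Aᵀ)))) ψ'')
        (EuclideanSpace.single n (1 : ℝ))) ψ).smulRight (EuclideanSpace.proj n : EuclideanSpace ℝ ι →L[ℝ] ℝ))‖ ≤
      Real.sqrt ((k5s3 + 3 * (αr * k5s3 * (αc * hc) * dr * dc / (1 - lamA)) + 3 * (αr * k4s2 * (αc * k3c) * dr * dc / (1 - lamA)) + 10 * (n₃ * (C3k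
        * S ^ 2)) + αr * hr * (αc * k5c) * dr * dc / (1 - lamA) + 3 * (αr * k3m * (αc * k4c) * dr * dc / (1 - lamA)) + αr * k5s4 * (αc * hc) * dr *
        dc / (1 - lamA) + 3 * (αr * k4s3 * (αc * k3c) * dr * dc / (1 - lamA)) + αr * k3r * (αc * k4c) * dr * dc / (1 - lamA) + 15 * ((n : ℝ) * n *
        (C3h * S ^ 2)) + 10 * ((n : ℝ) * (C4 * (16 * S' ^ 3))) + C5 * (576 * S₁ ^ 4)) * (k5s4 + 4 * (αr * k5s4 * (αc * hc) * dr * dc / (1 - lamA)) +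
        6 * (αr * k4s3 * (αc * k3c) * dr * dc / (1 - lamA)) + 10 * (n₃ * (C3k * S ^ 2)) + αr * hr * (αc * k5c) * dr * dc / (1 - lamA) + 4 * (αr *
        k3m * (αc * k4c) * dr * dc / (1 - lamA)) + 15 * ((n : ℝ) * n * (C3h * S ^ 2)) + 10 * ((n : ℝ) * (C4 * (16 * S' ^ 3))) + C5 * (576 * S₁ ^
        4))) := by
  have hC3k0 : 0 ≤ C3k := le_trans (mul_nonneg (by norm_num) (Real.sqrt_nonneg _)) hC3k
  have hC3h0 : 0 ≤ C3h := le_trans (mul_nonneg (by norm_num) (Real.sqrt_nonneg _)) hC3h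
  refine opNorm_le_of_slot_letters_five _ (fun t => ?_) (fun s => ?_)
  · exact sum4_first_to_last_le (fun x y z s => output_fifth_entry_format hΓop Y hUd hU'd hU''d hU₃d hU₄d hU₅c hκ₀ hκ₁ ha hτ hδ hθ0 hθ1 hκθ hκθw
      hstab hU'b hU''b hU₃b hU₄b hU₅b hlam hUsec hρg hHk hHk0 hK3 hK30 hK4 hK40 hK5 hhr ψ hαr hαc hlamA hlamA1 hγ hγ1 hD hDC hθnn hDθr hdθ hDθc hdθ'
      hσ0 hσθ hρ1 hρsymm hρmul hρσ hr1 hrσ haσ hβ haσ' hgσ hgσ' hkσ hkσ' hC3k hC3h hC4 hC5 x y z t s) (entry_majorant5_slot_t hK50 hK40 hK30 hHk0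
      hhr hhc hk3r hk3m hk3c hk4s2 hk4s3 hk4c hk5s3 hk5s4 hk5c hαr hαc hlamA1 hD hDr hDc hρ1 hρsymm hS hr1 hrs hSr hSc hS1 hn hn' hn3 hn3f hn3m
      hC3k0 hC3h0 hC40 hC50 t)
  · exact sum4_first_to_last_le (fun x y z t => output_fifth_entry_format hΓop Y hUd hU'd hU''d hU₃d hU₄d hU₅c hκ₀ hκ₁ ha hτ hδ hθ0 hθ1 hκθ hκθw
      hstab hU'b hU''b hU₃b hU₄b hU₅b hlam hUsec hρg hHk hHk0 hK3 hK30 hK4 hK40 hK5 hhr ψ hαr hαc hlamA hlamA1 hγ hγ1 hD hDC hθnn hDθr hdθ hDθc hdθ'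
      hσ0 hσθ hρ1 hρsymm hρmul hρσ hr1 hrσ haσ hβ haσ' hgσ hgσ' hkσ hkσ' hC3k hC3h hC4 hC5 x y z t s) (entry_majorant5_slot_s hK50 hK40 hK30 hHk0
      hhr hhc hk3m hk3c hk4s3 hk4c hk5s4 hk5c hαr hαc hlamA1 hD hDr hDc hρ1 hρsymm hS hr1 hrs hSr hSc hS1 hn hn' hn3 hn3m hC3k0 hC3h0 hC40 hC50 s)

end TheEnd

/-! ## §3. Toy -/

/-- Toy (the shape of the letter): equal slot letters `L ≥ 0` give `√(L·L) = L`. -/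
example (L : ℝ) (hL : 0 ≤ L) : Real.sqrt (L * L) = L := Real.sqrt_mul_self hL

end Summit.QuantumFields.BalabanUV.T4Continuum.NE7b.SupFifthOrderOperatorLetter

end
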